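import Mathlib
import Summits.Ventures.PercRepro2.Tail2DFlowOnePar

/-!
# (SD) on `(X ∥ Y) ∥ e` for flow-one `X, Y`: the one-edge step on top of the flow-one theorem
(seat mine-b, cell pub-perc-repro2; conjectures/MINE-B.md §42)

The lane's one-edge parallel step (`sdomZ_par_free`, §41.5) needs (SD) of the base at the two fibre positions and
the anti-diagonal log-concavity `TailLC` of its tails.  For the base `X ∥ Y` with flow-one factors the tails are
explicit (`tailCount_par_*`: `#E(2,0) = #E(0,2) = a a'`, `#E(1,1) = 2 a a'`, `#E(1,0) = #E(0,1) = L`,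
`#E(0,0) = n n'`, zero beyond total flow `2`), so `TailLC` at every clipped position is a polynomial inequality in
the four counts — `a a' ≤ L ≤ n n'` and `a a' n n' ≤ L²` (from `n ≥ 2a`, `n' ≥ 2a'`) — and (SD) follows on
`(X ∥ Y) ∥ e` and `e ∥ (X ∥ Y)` at every clipped position (`sdomZ_flowOne_par_free`, `sdomZ_flowOne_free_par`).
-/

namespace Summit.Ventures.PercRepro2.Tail2D

open V2Closure Finset

section Edge

variable (s t : V2Closure.SP)

/-- `2 #R ≤ #all` for a flow-one network (the blue crossings are as many and disjoint) -/
theorem two_mul_card_rSet_le (hs : FlowOne s) : 2 * (rSet s).card ≤ Fintype.card s.Conf := by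
  have h1 : (rSet s).card + (colSet s).card = Fintype.card s.Conf := by
    rw [card_colSet s hs]; have := card_rSet_le s; omega
  have h2 : (bSet s).card ≤ (colSet s).card := by
    apply Finset.card_le_card
    intro x hx
    rw [mem_bSet] at hx; rw [mem_colSet]; have := hs x; omega
  rw [card_bSet_eq] at h2
  omega

/-- the tail count of `X ∥ Y` at the clipped position `(a, c)`, as a function of the four counts -/
theorem tailCount_par_clip (hs : FlowOne s) (ht : FlowOne t) (a c : ℕ) :
    tailCount (V2Closure.SP.par s t) a c =
      if 3 ≤ a + c then 0
      else if a = 0 ∧ c = 0 then Fintype.card s.Conf * Fintype.card t.Conf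
      else if (a = 1 ∧ c = 0) ∨ (a = 0 ∧ c = 1) then
        (rSet s).card * Fintype.card t.Conf + (Fintype.card s.Conf - (rSet s).card) * (rSet t).card
      else if a = 1 ∧ c = 1 then 2 * ((rSet s).card * (rSet t).card)
      else (rSet s).card * (rSet t).card := by
  by_cases h3 : 3 ≤ a + c
  · rw [if_pos h3]; exact tailCount_par_big s t hs ht a c h3
  rw [if_neg h3]
  rcases (show (a = 0 ∧ c = 0) ∨ (a = 1 ∧ c = 0) ∨ (a = 0 ∧ c = 1) ∨ (a = 1 ∧ c = 1) ∨ (a = 2 ∧ c = 0) ∨ (a = 0 ∧ c = 2)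
      by omega) with h | h | h | h | h | h
  · obtain ⟨rfl, rfl⟩ := h; simp [tailCount_par_00]
  · obtain ⟨rfl, rfl⟩ := h; simp [tailCount_par_10 s t hs ht]
  · obtain ⟨rfl, rfl⟩ := h; rw [tailCount_par_symm s t 0 1, tailCount_par_10 s t hs ht]; simp
  · obtain ⟨rfl, rfl⟩ := h; simp [tailCount_par_11 s t hs ht]
  · obtain ⟨rfl, rfl⟩ := h; simp [tailCount_par_20 s t hs ht]
  · obtain ⟨rfl, rfl⟩ := h; simp [tailCount_par_02 s t hs ht]

/-- the three numeric facts behind the log-concavity: `a a' ≤ L`, `L ≤ n n'`, `a a' n n' ≤ L²` -/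
theorem flowOne_L_facts :
    (rSet s).card * (rSet t).card
        ≤ (rSet s).card * Fintype.card t.Conf + (Fintype.card s.Conf - (rSet s).card) * (rSet t).card ∧
    (rSet s).card * Fintype.card t.Conf + (Fintype.card s.Conf - (rSet s).card) * (rSet t).card
        ≤ Fintype.card s.Conf * Fintype.card t.Conf ∧
    (rSet s).card * (rSet t).card * (Fintype.card s.Conf * Fintype.card t.Conf)
        ≤ ((rSet s).card * Fintype.card t.Conf + (Fintype.card s.Conf - (rSet s).card) * (rSet t).card)
          * ((rSet s).card * Fintype.card t.Conf + (Fintype.card s.Conf - (rSet s).card) * (rSet t).card) := by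
  have h3 := card_rSet_le s; have h4 := card_rSet_le t
  obtain ⟨m, hm⟩ := Nat.exists_eq_add_of_le h3
  obtain ⟨m', hm'⟩ := Nat.exists_eq_add_of_le h4
  rw [hm, hm', Nat.add_sub_cancel_left]
  refine ⟨?_, ?_, ?_⟩
  · nlinarith
  · nlinarith
  · have key : (rSet s).card * (rSet t).card * (((rSet s).card + m) * ((rSet t).card + m'))
        + ((rSet s).card * (rSet s).card * ((rSet t).card + m') * m'
          + (rSet s).card * m * (rSet t).card * ((rSet t).card + m') + m * m * (rSet t).card * (rSet t).card)
        = ((rSet s).card * ((rSet t).card + m') + m * (rSet t).card)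
          * ((rSet s).card * ((rSet t).card + m') + m * (rSet t).card) := by ring
    omega

/-- the clipped red coordinates `(u⁺, (u−1)⁺, (u−2)⁺)` take one of five shapes -/
theorem clip_u (u : ℤ) :
    (u.toNat = 0 ∧ (u - 1).toNat = 0 ∧ (u - 2).toNat = 0) ∨ (u.toNat = 1 ∧ (u - 1).toNat = 0 ∧ (u - 2).toNat = 0) ∨
    (u.toNat = 2 ∧ (u - 1).toNat = 1 ∧ (u - 2).toNat = 0) ∨ (u.toNat = 3 ∧ (u - 1).toNat = 2 ∧ (u - 2).toNat = 1) ∨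
    (4 ≤ u.toNat ∧ 3 ≤ (u - 1).toNat ∧ 2 ≤ (u - 2).toNat) := by
  rcases (show u ≤ 0 ∨ u = 1 ∨ u = 2 ∨ u = 3 ∨ 4 ≤ u by omega) with h | h | h | h | h
  · exact Or.inl ⟨by omega, by omega, by omega⟩
  · exact Or.inr (Or.inl ⟨by omega, by omega, by omega⟩)
  · exact Or.inr (Or.inr (Or.inl ⟨by omega, by omega, by omega⟩))
  · exact Or.inr (Or.inr (Or.inr (Or.inl ⟨by omega, by omega, by omega⟩)))
  · exact Or.inr (Or.inr (Or.inr (Or.inr ⟨by omega, by omega, by omega⟩)))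

/-- the clipped blue coordinates `((v−1)⁺, v⁺, (v+1)⁺)` take one of five shapes -/
theorem clip_v (v : ℤ) :
    ((v - 1).toNat = 0 ∧ v.toNat = 0 ∧ (v + 1).toNat = 0) ∨ ((v - 1).toNat = 0 ∧ v.toNat = 0 ∧ (v + 1).toNat = 1) ∨
    ((v - 1).toNat = 0 ∧ v.toNat = 1 ∧ (v + 1).toNat = 2) ∨ ((v - 1).toNat = 1 ∧ v.toNat = 2 ∧ (v + 1).toNat = 3) ∨
    (2 ≤ (v - 1).toNat ∧ 3 ≤ v.toNat ∧ 4 ≤ (v + 1).toNat) := by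
  rcases (show v ≤ -1 ∨ v = 0 ∨ v = 1 ∨ v = 2 ∨ 3 ≤ v by omega) with h | h | h | h | h
  · exact Or.inl ⟨by omega, by omega, by omega⟩
  · exact Or.inr (Or.inl ⟨by omega, by omega, by omega⟩)
  · exact Or.inr (Or.inr (Or.inl ⟨by omega, by omega, by omega⟩))
  · exact Or.inr (Or.inr (Or.inr (Or.inl ⟨by omega, by omega, by omega⟩)))
  · exact Or.inr (Or.inr (Or.inr (Or.inr ⟨by omega, by omega, by omega⟩)))

/-- the tail `E(0,1)` of `X ∥ Y` -/
theorem tailCount_par_01 (hs : FlowOne s) (ht : FlowOne t) :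
    tailCount (V2Closure.SP.par s t) 0 1
      = (rSet s).card * Fintype.card t.Conf + (Fintype.card s.Conf - (rSet s).card) * (rSet t).card := by
  rw [tailCount_par_symm s t 0 1, tailCount_par_10 s t hs ht]

set_option maxHeartbeats 1000000 in
/-- **the anti-diagonal log-concavity of the tails of `X ∥ Y`** at every clipped position -/
theorem tailLC_flowOne_par (hs : FlowOne s) (ht : FlowOne t) (u v : ℤ) : TailLC (V2Closure.SP.par s t) u v := by
  unfold TailLC
  obtain ⟨f1, f2, f3⟩ := flowOne_L_facts s t
  have big := tailCount_par_big s t hs ht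
  have t00 := tailCount_par_00 s t; have t10 := tailCount_par_10 s t hs ht; have t01 := tailCount_par_01 s t hs ht
  have t20 := tailCount_par_20 s t hs ht; have t11 := tailCount_par_11 s t hs ht; have t02 := tailCount_par_02 s t hs ht
  rcases clip_u u with ⟨h1, h2, h3⟩ | ⟨h1, h2, h3⟩ | ⟨h1, h2, h3⟩ | ⟨h1, h2, h3⟩ | ⟨h1, h2, h3⟩ <;>
  rcases clip_v v with ⟨k1, k2, k3⟩ | ⟨k1, k2, k3⟩ | ⟨k1, k2, k3⟩ | ⟨k1, k2, k3⟩ | ⟨k1, k2, k3⟩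
  all_goals first
    | (rw [big u.toNat (v - 1).toNat (by omega)]; simp)
    | (rw [big (u - 2).toNat (v + 1).toNat (by omega)]; simp)
    | (rw [h1, h2, h3, k1, k2, k3]; done)
    | (rw [h1, h2, h3, k1, k2, k3]
       simp only [t00, t10, t01, t20, t11, t02]
       first
         | done
         | exact Nat.mul_le_mul f2 f2
         | exact Nat.mul_le_mul_right _ f1
         | exact Nat.mul_le_mul_left _ f1
         | exact Nat.mul_le_mul_left _ f2
         | exact f3
         | (rw [Nat.mul_comm]; exact f3)
         | exact Nat.mul_le_mul (Nat.le_mul_of_pos_left _ (by norm_num)) (Nat.le_mul_of_pos_left _ (by norm_num))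
         | nlinarith [f1, f2, f3])

/-- **(SD) on `(X ∥ Y) ∥ e`** at every clipped position, for flow-one `X, Y` with red crossings -/
theorem sdomZ_flowOne_par_free (hs : FlowOne s) (ht : FlowOne t) (ha : 0 < (rSet s).card) (ha' : 0 < (rSet t).card)
    (u v : ℤ) : SDomZ (V2Closure.SP.par (V2Closure.SP.par s t) V2Closure.SP.free) u v :=
  sdomZ_par_free _ u v (sdomZ_flowOne_par s t hs ht ha ha' _ _) (sdomZ_flowOne_par s t hs ht ha ha' _ _)
    (tailLC_flowOne_par s t hs ht u v)

/-- **(SD) on `e ∥ (X ∥ Y)`** at every clipped position, for flow-one `X, Y` with red crossings -/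
theorem sdomZ_flowOne_free_par (hs : FlowOne s) (ht : FlowOne t) (ha : 0 < (rSet s).card) (ha' : 0 < (rSet t).card)
    (u v : ℤ) : SDomZ (V2Closure.SP.par V2Closure.SP.free (V2Closure.SP.par s t)) u v :=
  sdomZ_free_par _ u v (sdomZ_flowOne_par s t hs ht ha ha' _ _) (sdomZ_flowOne_par s t hs ht ha ha' _ _)
    (tailLC_flowOne_par s t hs ht u v)

end Edge

end Summit.Ventures.PercRepro2.Tail2D
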